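import Mathlib
import Summits.ResolutionOfSingularities.ResolutionOfSingularities.Theorems.RadicialJungCleanModelsCleanLU3ArcCorePrelims
import Summits.ResolutionOfSingularities.ResolutionOfSingularities.Theorems.RadicialJungCleanModelsCleanLU3ArcApprox
import Summits.ResolutionOfSingularities.ResolutionOfSingularities.Theorems.RadicialJungCleanModelsCleanLU3ArcTaylor
import Summits.ResolutionOfSingularities.ResolutionOfSingularities.Theorems.RadicialJungCleanModelsCleanLU3ArcPrelims
import HarnessLib

/-!
# Route `RadicialJung`, crux `CleanModels` (stmt-15917), stub `stub_cleanLU3DefectArcInfinite`: the core, part 1 — the ORDER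
# ESTIMATE: at stage `j = pL - α` the representative `h - c^p` has `𝔪ⱼ`-adic order `≥ j + α + 1` and value `≥ j + α + 2`

Line `Sketch` rev 20 of crux stmt-ResolutionOfSingularities-15917; lead `res-B-lead-1` g3.  OURS; nothing here proves resolution in
characteristic `p`.  This is §5/§7.4 of res-B-lens-5 g6's hand proof (`Cruxes/DescentPerfectToAll/CLASSA-rational-arcs-lens5.md`),
ALGEBRAIZED: the formal coefficient field is replaced by `Q`-constants (`…ArcQConst`, `…ArcRep`), the formal arc by the tower form
(`…ArcTower`), the Taylor expansion by `…ArcTaylor`, the index gain by `…ArcApprox`; `α = min_l v(∂_l h)` for derivations `∂_l` dual to a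
regular system of parameters `(π, a₁, a₂)`.
-/

noncomputable section

set_option linter.dupNamespace false -- mandated namespace of this single-conjunct summit

open IsLocalRing Polynomial
open Literature.AlgebraicGeometry.Resolution

namespace Summit.ResolutionOfSingularities.ResolutionOfSingularities.Theorems.RadicialJung.CleanModels

variable {K : Type} [Field K]

/-! ## Coercion helpers -/

/-- Evaluating the image of a `T`-polynomial in a larger subring `S`, coerced to `K`, is `aeval` in `K`. [folklore] -/
theorem coe_eval_map_inclusion {σ : Type*} {T S : Subring K} (hTS : T ≤ S) (H : MvPolynomial σ T) (v : σ → S) :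
    ((MvPolynomial.eval v (MvPolynomial.map (Subring.inclusion hTS) H) : S) : K) = MvPolynomial.aeval (fun i => (v i : K)) H := by
  rw [MvPolynomial.eval_map, MvPolynomial.aeval_def]
  rw [show ((MvPolynomial.eval₂ (Subring.inclusion hTS) v H : S) : K) = S.subtype (MvPolynomial.eval₂ (Subring.inclusion hTS) v H)
    from rfl, MvPolynomial.eval₂_comp_left]
  rfl

/-- `aeval` is unchanged by enlarging the coefficient subring. [folklore] -/
theorem aeval_map_inclusion {σ : Type*} {T S : Subring K} (hTS : T ≤ S) (H : MvPolynomial σ T) (v : σ → K) :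
    MvPolynomial.aeval v (MvPolynomial.map (Subring.inclusion hTS) H) = MvPolynomial.aeval v H := by
  rw [MvPolynomial.aeval_def, MvPolynomial.eval₂_map, MvPolynomial.aeval_def]; rfl

/-- A `T`-polynomial evaluated at an element of a subring `S ⊇ T` lies in `S`. [folklore] -/
theorem polynomial_aeval_mem {T S : Subring K} (hTS : T ≤ S) (P : Polynomial T) {x : K} (hx : x ∈ S) : aeval x P ∈ S := by
  rw [aeval_eq_sum_range]
  exact Subring.sum_mem _ fun i _ => by rw [Algebra.smul_def]; exact S.mul_mem (hTS (P.coeff i).2) (S.pow_mem hx _)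

/-- Composing: `(MvPolynomial.aeval Pt Hc)(π) = Hc(Pt(π))`. [folklore] -/
theorem aeval_mvPolynomial_aeval {σ : Type*} {T : Subring K} (Pt : σ → Polynomial T) (Hc : MvPolynomial σ T) (π : K) :
    aeval π (MvPolynomial.aeval Pt Hc) = MvPolynomial.aeval (fun l => aeval π (Pt l)) Hc :=
  DFunLike.congr_fun (MvPolynomial.comp_aeval Pt (Polynomial.aeval (R := T) π)) Hc

/-! ## The order estimate -/

/-- **Core, part 1 (order estimate).**  Along a quadratic sequence of regular local rings in the `π`-chart of a discrete rank-one
valuation, with `𝔪₀ = (π, a₁, a₂)`, perfect residue fields, dual derivations `E_l` (`E_l a_m = e δ_{lm}`, `e` a unit) preserving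
`R₀`, and `h ∈ R₀` with some `E_l h ≠ 0` which is a `p`-th power to every order: for `α = min_l v(E_l h)`, `L = α + 1`, `j = pL - α`
there is `c ∈ Rⱼ` with `h - c^p ∈ 𝔪ⱼ^{j+α+1}` and `v(h - c^p) ≤ v π ^ (j+α+2)`. [folklore] -/
theorem arc_infinite_order {O : ValuationSubring K} {p : ℕ} [hp : Fact p.Prime] [CharP K p]
    (R : ℕ → Subring K) [hR : ∀ i, IsLocalRing (R i)]
    (h0 : SubringDominates (R 0) O.toSubring) (hstep : ∀ i, IsQuadraticTransformAlong O (R i) (R (i + 1)))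
    (π : K) (hπR : π ∈ R 0) (hπ0 : π ≠ 0) (hvπ : O.valuation π < 1)
    (hπ : ∀ x : K, O.valuation x < 1 → O.valuation x ≤ O.valuation π)
    (harch : ∀ x : K, x ≠ 0 → ∃ n : ℕ, O.valuation π ^ n ≤ O.valuation x)
    (a : Fin 3 → K) (haR : ∀ l, a l ∈ R 0) (ha0 : a 0 = π)
    (hm : maximalIdeal (R 0) = Ideal.span (Set.range fun l => (⟨a l, haR l⟩ : R 0)))
    (hperf : ∀ (i : ℕ) (b : K), b ∈ R i → ∃ t : K, t ∈ R i ∧ O.valuation (b - t ^ p) < 1)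
    (hperfO : ∀ b : K, b ∈ O → ∃ t : K, t ∈ O ∧ O.valuation (b - t ^ p) < 1)
    (E : Fin 3 → Derivation ℤ K K) (hE : ∀ l y, y ∈ R 0 → E l y ∈ R 0) (e : K)
    (hve : O.valuation e = 1) (hdual : ∀ l m, E l (a m) = if l = m then e else 0)
    (h : K) (hh : h ∈ R 0) (hEh : ∃ l, E l h ≠ 0)
    (happrox : ∀ N : ℕ, ∃ b : K, O.valuation (h - b ^ p) ≤ O.valuation π ^ N) :
    ∃ (l₀ : Fin 3) (α j L : ℕ) (c : K) (hc : c ∈ R j), j + α = p * L ∧ α + 1 ≤ j ∧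
      O.valuation (E l₀ h) = O.valuation π ^ α ∧
      O.valuation (h - c ^ p) ≤ O.valuation π ^ (j + α + 2) ∧
      (⟨h - c ^ p, (R j).sub_mem (sequence_monotone hstep (Nat.zero_le j) hh) ((R j).pow_mem hc p)⟩ : R j) ∈
        maximalIdeal (R j) ^ (j + α + 1) := by
  classical
  -- (S0) basics
  have hvπ1 : O.valuation π ≤ 1 := hvπ.le
  have hvπpos : 0 < O.valuation π := zero_lt_iff.mpr ((Valuation.ne_zero_iff _).mpr hπ0)
  have hanti : ∀ {i j : ℕ}, i ≤ j → O.valuation π ^ j ≤ O.valuation π ^ i := fun hij => pow_le_pow_right_of_le_one' hvπ1 hij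
  have hdom : ∀ i, SubringDominates (R i) O.toSubring := fun i => (sequence_dominates h0 hstep i).1
  have hmemR : ∀ i (z : R i), z ∈ maximalIdeal (R i) ↔ O.valuation (z : K) < 1 := fun i =>
    (subringDominates_valuationSubring_iff (hdom i).1).mp (hdom i)
  have hmono : ∀ {i j : ℕ}, i ≤ j → R i ≤ R j := fun hij => sequence_monotone hstep hij
  have hle1 : ∀ i (z : K), z ∈ R i → O.valuation z ≤ 1 := fun i z hz => (O.valuation_le_one_iff _).mpr ((hdom i).1 hz)
  have hπO : π ∈ O := (hdom 0).1 hπR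
  -- (S1) `α` and `l₀`
  have hex : ∃ n : ℕ, ∃ l, E l h ≠ 0 ∧ O.valuation (E l h) = O.valuation π ^ n := by
    obtain ⟨l, hl⟩ := hEh
    obtain ⟨n, hn⟩ := exists_valuation_eq_pow_of_discrete O π hπ harch (E l h) hl ((hdom 0).1 (hE l h hh))
    exact ⟨n, l, hl, hn⟩
  let α := Nat.find hex
  obtain ⟨l₀, hl₀, hαeq⟩ : ∃ l, E l h ≠ 0 ∧ O.valuation (E l h) = O.valuation π ^ α := Nat.find_spec hex
  have hEle : ∀ l, O.valuation (E l h) ≤ O.valuation π ^ α := by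
    intro l
    by_cases hl : E l h = 0
    · rw [hl, map_zero]; exact zero_le
    · obtain ⟨n, hn⟩ := exists_valuation_eq_pow_of_discrete O π hπ harch (E l h) hl ((hdom 0).1 (hE l h hh))
      have hαn : α ≤ n := Nat.find_min' hex ⟨l, hl, hn⟩
      rw [hn]; exact hanti hαn
  -- (S2) parameters
  set L : ℕ := α + 1 with hL
  have hpL : α + 2 ≤ p * L - α ∧ p * L - α + α = p * L := by
    have h2 : 2 * L ≤ p * L := Nat.mul_le_mul_right L hp.out.two_le
    constructor <;> omega
  set j : ℕ := p * L - α with hjdef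
  have hjα : j + α = p * L := hpL.2
  have hj1 : α + 1 ≤ j := by omega
  set d : ℕ := j + α + 1 with hd
  set s : ℕ := d + 2 with hsdef
  have hsQ : d + 2 < p ^ s := Nat.lt_pow_self hp.out.one_lt
  have hs0 : s ≠ 0 := by omega
  have hdQ : d ≤ p ^ s := by omega
  -- (S3) representation of `h` modulo `𝔪₀^Q` with `Q`-constant coefficients, moved to the coefficients `T = Rⱼ^Q`
  let T : Subring K := (R j).map (iterateFrobenius K p s)
  have hTRj : T ≤ R j := map_iterateFrobenius_le (R j) s
  have hT0T : (R 0).map (iterateFrobenius K p s) ≤ T := fun z hz => by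
    obtain ⟨r, hr, rfl⟩ := Subring.mem_map.mp hz
    exact Subring.mem_map.mpr ⟨r, hmono (Nat.zero_le j) hr, rfl⟩
  obtain ⟨H0, mQ, hmQ, hrep⟩ := exists_mvPolynomial_rep (hdom 0) (hperf 0) s (fun l => (⟨a l, haR l⟩ : R 0)) hm (p ^ s) ⟨h, hh⟩
  let Hc : MvPolynomial (Fin 3) T := MvPolynomial.map (Subring.inclusion hT0T) H0
  have hrep' : h = MvPolynomial.aeval a Hc + (mQ : K) := by
    have := hrep; rw [aeval_map_inclusion]; exact this
  have hvmQ : O.valuation (mQ : K) ≤ O.valuation π ^ p ^ s := valuation_le_pow_of_mem_pow (hdom 0) π hπ _ mQ hmQ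
  -- (S4) `h_l` and the bound `v h_l ≤ v π ^ α`
  let hl : Fin 3 → K := fun l => MvPolynomial.aeval a (MvPolynomial.pderiv l Hc)
  have hchain : ∀ D : Derivation ℤ K K, D (MvPolynomial.aeval a Hc) = ∑ m, hl m * D (a m) := fun D =>
    MvPolynomial.derivation_aeval_eq_sum D (fun t => derivation_apply_qconst D (R j) hs0 t) a Hc
  have hElh : ∀ l, E l h = hl l * e + E l (mQ : K) := by
    intro l
    rw [hrep', map_add, hchain]
    simp_rw [hdual l, mul_ite, mul_zero, Finset.sum_ite_eq, Finset.mem_univ, if_true]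
  have hvEmQ : ∀ l, O.valuation (E l (mQ : K)) ≤ O.valuation π ^ (p ^ s - 1) := by
    intro l
    have hD1 : ∀ y ∈ R 0, (1 : K) * E l y ∈ R 0 := fun y hy => by rw [one_mul]; exact hE l y hy
    have hps : p ^ s = (p ^ s - 1) + 1 := by omega
    have h1 := derivation_apply_mem_pow (E l) 1 hD1 (p ^ s - 1) mQ (hps ▸ hmQ)
    have h2 := valuation_le_pow_of_mem_pow (hdom 0) π hπ _ _ h1
    simpa only [one_mul] using h2
  have hvhl : ∀ l, O.valuation (hl l) ≤ O.valuation π ^ α := by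
    intro l
    have e1 : hl l = (E l h - E l (mQ : K)) * e⁻¹ := by
      rw [hElh l, add_sub_cancel_right, mul_assoc, mul_inv_cancel₀ (ne_zero_of_valuation_eq_one hve), mul_one]
    rw [e1, map_mul, map_inv₀, hve, inv_one, mul_one]
    refine (Valuation.map_sub _ _ _).trans (max_le (hEle l) ((hvEmQ l).trans (hanti (by omega))))
  -- (S5) tower forms of `a₁`, `a₂` at stage `j`
  have haval : ∀ l, l ≠ 0 → O.valuation (a l) < 1 := fun l _ =>
    (hmemR 0 ⟨a l, haR l⟩).mp (by rw [hm]; exact Ideal.subset_span ⟨l, rfl⟩)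
  obtain ⟨P₁, θ₁, hθ₁, hvθ₁, ha₁⟩ := exists_tower_form R h0 hstep π hπR hπ0 hvπ hπ hperf s j (a 1) (haR 1) (haval 1 one_ne_zero)
  obtain ⟨P₂, θ₂, hθ₂, hvθ₂, ha₂⟩ := exists_tower_form R h0 hstep π hπR hπ0 hvπ hπ hperf s j (a 2) (haR 2)
    (haval 2 (by decide))
  let Pt : Fin 3 → Polynomial T := ![Polynomial.X, P₁, P₂]
  let θv : Fin 3 → K := ![0, θ₁, θ₂]
  have hπj : π ∈ R j := hmono (Nat.zero_le j) hπR
  have hθR : ∀ l, θv l ∈ R j := by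
    intro l; fin_cases l
    · exact (R j).zero_mem
    · exact hθ₁
    · exact hθ₂
  have hθv : ∀ l, O.valuation (θv l) ≤ O.valuation π := by
    intro l; fin_cases l
    · change O.valuation (0 : K) ≤ _; rw [map_zero]; exact zero_le
    · exact hπ _ hvθ₁
    · exact hπ _ hvθ₂
  have hθm : ∀ l, (⟨θv l, hθR l⟩ : R j) ∈ maximalIdeal (R j) := fun l =>
    (hmemR j _).mpr (lt_of_le_of_lt (hθv l) hvπ)
  have haeq : ∀ l, a l = aeval π (Pt l) + π ^ j * θv l := by
    intro l; fin_cases l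
    · change a 0 = aeval π Polynomial.X + π ^ j * 0; rw [aeval_X, mul_zero, add_zero, ha0]
    · exact ha₁
    · exact ha₂
  -- (S6) Taylor at stage `j` over `Rⱼ`
  let Hj : MvPolynomial (Fin 3) (R j) := MvPolynomial.map (Subring.inclusion hTRj) Hc
  let Pvec : Fin 3 → R j := fun l => ⟨aeval π (Pt l), polynomial_aeval_mem hTRj (Pt l) hπj⟩
  let θvec : Fin 3 → R j := fun l => ⟨θv l, hθR l⟩
  let tj : R j := ⟨π ^ j, (R j).pow_mem hπj j⟩
  obtain ⟨ρ, hTaylor⟩ := MvPolynomial.exists_eval_add_mul_eq Hj Pvec θvec tj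
  have havec : (fun l => Pvec l + tj * θvec l) = fun l => (⟨a l, hmono (Nat.zero_le j) (haR l)⟩ : R j) := by
    funext l; apply Subtype.ext; change aeval π (Pt l) + π ^ j * θv l = a l; exact (haeq l).symm
  have hHj : ∀ l, MvPolynomial.pderiv l Hj = MvPolynomial.map (Subring.inclusion hTRj) (MvPolynomial.pderiv l Hc) := fun l =>
    MvPolynomial.pderiv_map
  let Pa : Fin 3 → K := fun l => aeval π (Pt l)
  let G : K := MvPolynomial.aeval Pa Hc
  let C : Fin 3 → K := fun l => MvPolynomial.aeval Pa (MvPolynomial.pderiv l Hc)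
  have hcoeG : ((MvPolynomial.eval Pvec Hj : R j) : K) = G := coe_eval_map_inclusion hTRj Hc Pvec
  have hcoeC : ∀ l, ((MvPolynomial.eval Pvec (MvPolynomial.pderiv l Hj) : R j) : K) = C l := fun l => by
    rw [hHj]; exact coe_eval_map_inclusion hTRj _ Pvec
  have hcoeh : ∀ l, ((MvPolynomial.eval (fun m => (⟨a m, hmono (Nat.zero_le j) (haR m)⟩ : R j)) (MvPolynomial.pderiv l Hj) : R j) : K) =
      hl l := fun l => by
    rw [hHj]; exact coe_eval_map_inclusion hTRj _ _
  have hcoeA : ((MvPolynomial.eval (fun l => Pvec l + tj * θvec l) Hj : R j) : K) = MvPolynomial.aeval a Hc := by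
    rw [havec]; exact coe_eval_map_inclusion hTRj Hc _
  have hTaylorK : MvPolynomial.aeval a Hc = G + π ^ j * (∑ l, θv l * C l) + (π ^ j) ^ 2 * (ρ : K) := by
    have := congrArg (fun z : R j => (z : K)) hTaylor
    simp only [Subring.coe_add, Subring.coe_mul, Subring.coe_pow, AddSubmonoidClass.coe_finsetSum, hcoeG, hcoeC, hcoeA] at this
    exact this
  -- (S7) `v C_l ≤ v π ^ α`
  have hvC : ∀ l, O.valuation (C l) ≤ O.valuation π ^ α := by
    intro l
    obtain ⟨G', hG'⟩ := MvPolynomial.exists_eval_sub_eval_eq (MvPolynomial.pderiv l Hj) Pvec (fun m => Pvec m + tj * θvec m)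
    rw [havec] at hG'
    have hK : C l - hl l = ∑ m, (-(π ^ j * θv m)) * (G' m : K) := by
      have h1 := congrArg (fun z : R j => (z : K)) hG'
      simp only [AddSubgroupClass.coe_sub, AddSubmonoidClass.coe_finsetSum, Subring.coe_mul, hcoeC, hcoeh] at h1
      rw [h1]
      refine Finset.sum_congr rfl fun m _ => ?_
      have em : ((Pvec m : R j) : K) - ((Pvec m + tj * θvec m : R j) : K) = -(π ^ j * θv m) := by
        rw [Subring.coe_add, Subring.coe_mul]
        change aeval π (Pt m) - (aeval π (Pt m) + π ^ j * θv m) = _; ring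
      rw [em]
    have hvdiff : O.valuation (C l - hl l) ≤ O.valuation π ^ (j + 1) := by
      rw [hK]
      refine Valuation.map_sum_le _ fun m _ => ?_
      rw [map_mul, Valuation.map_neg, map_mul, map_pow, pow_succ]
      calc O.valuation π ^ j * O.valuation (θv m) * O.valuation (G' m : K) ≤ O.valuation π ^ j * O.valuation π * 1 :=
            mul_le_mul' (mul_le_mul_right (hθv m) _) (hle1 j _ (G' m).2)
        _ = O.valuation π ^ j * O.valuation π := mul_one _
    have e1 : C l = (C l - hl l) + hl l := by ring
    rw [e1]
    exact (Valuation.map_add _ _ _).trans (max_le (hvdiff.trans (hanti (by omega))) (hvhl l))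
  -- (S8) values of the Taylor terms; `v (h - G) ≤ v π ^ d`
  have hvT1 : O.valuation (π ^ j * ∑ l, θv l * C l) ≤ O.valuation π ^ d := by
    rw [map_mul, map_pow, hd, show j + α + 1 = j + (1 + α) by ring, pow_add]
    refine mul_le_mul_right (Valuation.map_sum_le _ fun l _ => ?_) _
    rw [map_mul, pow_add, pow_one]
    exact mul_le_mul' (hθv l) (hvC l)
  have hvT2 : O.valuation ((π ^ j) ^ 2 * (ρ : K)) ≤ O.valuation π ^ d := by
    rw [map_mul, map_pow, map_pow, ← pow_mul]
    calc O.valuation π ^ (j * 2) * O.valuation (ρ : K) ≤ O.valuation π ^ (j * 2) * 1 := mul_le_mul_right (hle1 j _ ρ.2) _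
      _ = O.valuation π ^ (j * 2) := mul_one _
      _ ≤ O.valuation π ^ d := hanti (by omega)
  have hvT3 : O.valuation (mQ : K) ≤ O.valuation π ^ d := hvmQ.trans (hanti hdQ)
  have hvhG : O.valuation (h - G) ≤ O.valuation π ^ d := by
    have e1 : h - G = π ^ j * (∑ l, θv l * C l) + (π ^ j) ^ 2 * (ρ : K) + (mQ : K) := by rw [hrep', hTaylorK]; ring
    rw [e1]
    exact (Valuation.map_add _ _ _).trans (max_le ((Valuation.map_add _ _ _).trans (max_le hvT1 hvT2)) hvT3)
  -- (S9) the approximant `c`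
  obtain ⟨b, hb⟩ := happrox (d + 1)
  have hbO : b ∈ O := by
    rw [← O.valuation_le_one_iff]
    have hbp : O.valuation (b ^ p) ≤ 1 := by
      have e1 : b ^ p = h - (h - b ^ p) := by ring
      rw [e1]
      exact (Valuation.map_sub _ _ _).trans (max_le (hle1 0 h hh) (hb.trans (pow_le_one₀ zero_le hvπ1)))
    rw [map_pow] at hbp
    exact (pow_le_one_iff_of_nonneg zero_le hp.out.ne_zero).mp hbp
  let Ĝ : Polynomial T := MvPolynomial.aeval Pt Hc
  have hĜ : aeval π Ĝ = G := aeval_mvPolynomial_aeval Pt Hc π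
  have hGb : O.valuation (aeval π Ĝ - b ^ p) ≤ O.valuation π ^ d := by
    rw [hĜ, show G - b ^ p = -(h - G) + (h - b ^ p) by ring]
    refine (Valuation.map_add _ _ _).trans (max_le ?_ (hb.trans (hanti (Nat.le_succ d))))
    rw [Valuation.map_neg]; exact hvhG
  have hLd : p * L < d := by omega
  obtain ⟨ĉ, hĉ⟩ := exists_approximant_of_qconst O π hπO hπ0 hvπ hπ hperfO (hdom j).1 (hperf j) s Ĝ b hbO d L hLd hdQ hGb
  set c : K := aeval π ĉ with hcdef
  have hcR : c ∈ R j := polynomial_aeval_mem hTRj ĉ hπj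
  have hvf : O.valuation (h - c ^ p) ≤ O.valuation π ^ (j + α + 2) := by
    have e1 : h - c ^ p = (h - b ^ p) + -((c - b) ^ p) := by rw [sub_pow_char]; ring
    rw [e1]
    refine (Valuation.map_add _ _ _).trans (max_le (hb.trans_eq (by rw [hd])) ?_)
    rw [Valuation.map_neg, map_pow]
    calc O.valuation (c - b) ^ p ≤ (O.valuation π ^ (L + 1)) ^ p := pow_le_pow_left' hĉ p
      _ = O.valuation π ^ (p * (L + 1)) := by rw [← pow_mul, mul_comm]
      _ ≤ O.valuation π ^ (j + α + 2) := hanti (by nlinarith [hp.out.two_le])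
  -- (S10) the order of `f = h - c^p`
  refine ⟨l₀, α, j, L, c, hcR, hjα, hj1, hαeq, hvf, ?_⟩
  have hπm : (⟨π, hπj⟩ : R j) ∈ maximalIdeal (R j) := (hmemR j _).mpr hvπ
  -- the four pieces as elements of `R j`
  have hGc_mem : G - c ^ p ∈ R j := by
    rw [← hĜ, hcdef, ← map_pow, ← map_sub]; exact polynomial_aeval_mem hTRj _ hπj
  have hpiece1 : (⟨G - c ^ p, hGc_mem⟩ : R j) ∈ maximalIdeal (R j) ^ d := by
    have hv : O.valuation (aeval π (Ĝ - ĉ ^ p)) ≤ O.valuation π ^ d := by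
      rw [map_sub, map_pow, hĜ, ← hcdef]
      have e1 : G - c ^ p = (h - c ^ p) + -(π ^ j * ∑ l, θv l * C l) + -((π ^ j) ^ 2 * (ρ : K)) + -(mQ : K) := by
        rw [hrep', hTaylorK]; ring
      rw [e1]
      refine (Valuation.map_add _ _ _).trans (max_le ((Valuation.map_add _ _ _).trans (max_le ((Valuation.map_add _ _ _).trans
        (max_le (hvf.trans (hanti (by omega))) ?_)) ?_)) ?_)
      · rw [Valuation.map_neg]; exact hvT1
      · rw [Valuation.map_neg]; exact hvT2
      · rw [Valuation.map_neg]; exact hvT3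
    have := aeval_mem_pow_of_valuation_le (hdom j) π hπj hπ0 hvπ hπ s (Ĝ - ĉ ^ p) d hdQ hv
      (polynomial_aeval_mem hTRj _ hπj)
    convert this using 2
    rw [map_sub, map_pow, hĜ]
  have hCmem : ∀ l, C l ∈ R j := fun l => hcoeC l ▸ (MvPolynomial.eval Pvec _).2
  have hT1mem : π ^ j * ∑ l, θv l * C l ∈ R j :=
    (R j).mul_mem ((R j).pow_mem hπj j) (Subring.sum_mem _ fun l _ => (R j).mul_mem (hθR l) (hCmem l))
  have hpiece2 : (⟨π ^ j * ∑ l, θv l * C l, hT1mem⟩ : R j) ∈ maximalIdeal (R j) ^ d := by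
    have hCpow : ∀ l, (⟨C l, hCmem l⟩ : R j) ∈ maximalIdeal (R j) ^ α := by
      intro l
      have e1 : C l = aeval π (MvPolynomial.aeval Pt (MvPolynomial.pderiv l Hc)) := (aeval_mvPolynomial_aeval Pt _ π).symm
      have := aeval_mem_pow_of_valuation_le (hdom j) π hπj hπ0 hvπ hπ s (MvPolynomial.aeval Pt (MvPolynomial.pderiv l Hc)) α
        (by omega) (e1 ▸ hvC l) (polynomial_aeval_mem hTRj _ hπj)
      convert this using 2
    have e1 : (⟨π ^ j * ∑ l, θv l * C l, hT1mem⟩ : R j) =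
        (⟨π, hπj⟩ : R j) ^ j * ∑ l, (⟨θv l, hθR l⟩ : R j) * ⟨C l, hCmem l⟩ := by
      apply Subtype.ext
      simp only [Subring.coe_mul, Subring.coe_pow, AddSubmonoidClass.coe_finsetSum]
    rw [e1, hd, show j + α + 1 = j + (1 + α) by ring, pow_add]
    refine Ideal.mul_mem_mul (Ideal.pow_mem_pow hπm j) (Ideal.sum_mem _ fun l _ => ?_)
    rw [pow_add, pow_one]
    exact Ideal.mul_mem_mul (hθm l) (hCpow l)
  have hpiece3 : tj ^ 2 * ρ ∈ maximalIdeal (R j) ^ d := by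
    have : tj ^ 2 * ρ ∈ maximalIdeal (R j) ^ (j * 2) := by
      rw [pow_mul]
      exact Ideal.mul_mem_right _ _ (Ideal.pow_mem_pow (Ideal.pow_mem_pow hπm j) 2)
    exact Ideal.pow_le_pow_right (by omega) this
  have hpiece4 : (⟨(mQ : K), hmono (Nat.zero_le j) mQ.2⟩ : R j) ∈ maximalIdeal (R j) ^ d :=
    Ideal.pow_le_pow_right hdQ (mem_pow_of_le R h0 hstep (Nat.zero_le j) (p ^ s) mQ hmQ)
  have hsum : (⟨h - c ^ p, (R j).sub_mem (sequence_monotone hstep (Nat.zero_le j) hh) ((R j).pow_mem hcR p)⟩ : R j) =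
      ⟨G - c ^ p, hGc_mem⟩ + ⟨π ^ j * ∑ l, θv l * C l, hT1mem⟩ + tj ^ 2 * ρ + ⟨(mQ : K), hmono (Nat.zero_le j) mQ.2⟩ := by
    apply Subtype.ext
    simp only [Subring.coe_add, Subring.coe_mul, Subring.coe_pow]
    change h - c ^ p = G - c ^ p + π ^ j * (∑ l, θv l * C l) + (π ^ j) ^ 2 * (ρ : K) + (mQ : K)
    rw [hrep', hTaylorK]; ring
  rw [hsum]
  exact Ideal.add_mem _ (Ideal.add_mem _ (Ideal.add_mem _ hpiece1 hpiece2) hpiece3) hpiece4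

end Summit.ResolutionOfSingularities.ResolutionOfSingularities.Theorems.RadicialJung.CleanModels

end
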